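import Summits.QuantumFields.BalabanUV.Beta.GAN24.DressedLegEnvelope
import Summits.QuantumFields.BalabanUV.Beta.GAN24.StaircaseFaceDensity

/-!
# `BalabanUV.Beta.GAN24.DressedLegSawtoothBlockL1` — binder row G-an2-4 ∕ (CONV-C), W-slot, the (α-0) parity re-cut, located crux (Q-L-k₀)
# (RULING R-gan24p1-g36-1 (4)(B), journal `CLAIMS.log` [GAN24P1-G36-RULING1]): **THE GAUGE SAWTOOTH OF THE DRESSED COMPOSITE LEGS IS
# `T^B`-SIZED IN BLOCK-ℓ¹** — the kernel-leg currency of the (H1♮) core `ThreeLegDoubleFreeze` (leaf-01 g74 INTENT 1)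
# (OWNER `b2b-balaban-gan24-p1`, gen 36)

NOT IN PRINT; OUR BOOKKEEPING ([folklore] face counting on `ℤ^{3+1}` over two tree inputs BY NAME; 0 `def`, 0 cited facts, 0 `def … : Prop`, 0 sorry).
HONEST FRAMING (cell contract, verbatim): «discharging `BetaPertH` makes Bałaban's UV stability UNCONDITIONAL — a real constructive-QFT result; it is NOT the
continuum limit and NOT the Clay problem.»  HONEST DEPENDENCY (verbatim): «continuum YM on T⁴ ⇐ BetaPertH ∧ nine spine estimates (0/9 proved); BetaPertH ⇐
(D1) ∧ (D4) ∧ CAP+tail; G-an2-4 gates asym, D1 and NE2/3/4.»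

WHY.  The dressed composite legs of the (E)∕(α-0) recursions are `T^E = Π^ρ_bm T^B + dz Ψ` (leaf-03 g41 `RespStepBmDecompPsi.legAct_legChain_respStepBm`), with the
accumulated inter-block gauge `Ψ = −Σ_{i<k} (Lc^{(d+1)(i+1)})⁻¹·bmGaugeAt(…)(blk (Lc^{i+1}) ·)` BLOCK-CONSTANT per intermediate level and, in sup, ONE POWER OF THE
RELATIVE BLOCKING ABOVE `T^B` (leaf-01 g57 `DressedLegUnits` ∕ `DressedLegEnvelope.Psi_single_envelope`: `16·C·(Lc^{4(k+1)})⁻¹` against `C·(Lc^{5(k+1)})⁻¹`).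
The (H1♮) core of the leg-letter window (leaf-01 g74 `ThreeLegDoubleFreeze`, mechanism «double first-moment freezing at the kernel leg's fine site») reads the
KERNEL leg only through its ℓ¹-mass on source blocks (the fine site of the kernel leg is the free summation variable).  In that currency the sawtooth costs NO
power: `dz Ψ_i` lives on the faces of the `Lc^{i+1}`-blocks (the OWNER's gen-18 `StaircaseFaces` (F1)), whose density `Lc^{−(i+1)}` (leaf-03 g54
`StaircaseFaceDensity.card_box_filter_dvd`) exactly compensates the level's amplitude — EVERY level contributes the same, `T^B`-sized, block mass.
WHAT (`d = 3`, `[NeZero Lc]`, in-block root `ρ = toSite rr`; PARAMETRIC in leaf-12's (N1) data `κ₀ ≥ 0`, `C ≥ 0` exactly as `DressedLegEnvelope` §2):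
* §1 `abs_PsiTerm_single_le` — the `i`-th term of `Ψ_{m,k}(single μ z)` at ANY fine point `y`: `≤ 8·Lc·C·(Lc^{5(k−i)})⁻¹·(Lc^{4(i+1)})⁻¹·e^{−κ₀‖quo (Lc^{k+1}) y − z‖∞}`
  (the `have hterm` of `Psi_single_envelope`, isolated); `abs_dz_PsiTerm_single_le` — its `κ`-gradient VANISHES off the `Lc^{i+1}`-faces and is `≤ 16·(…)·e^{κ₀}·(envelope at y)`
  on them (`StaircaseFaces.blk_add_unitVec_of_not_dvd`, `env_add_unitVec_le`).
* §2 `dz_Psi_apply` (the gradient of `Ψ` is the sum of the level gradients); `dvd_coord_iff` (on the source block `L•c + box`, `L = Lc^{k+1}`, the face condition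
  reads on the offset); **`sum_box_abs_dz_PsiTerm_single_le`** — PER LEVEL, the block-ℓ¹ mass of the level-`i` sawtooth over a source block is
  `≤ 16·Lc·e^{κ₀}·C·(Lc^{k+1})⁻¹·e^{−κ₀‖c − z‖∞}`, INDEPENDENT OF `i` (`#faces = L^3·L∕Lc^{i+1}`; `3(k+1) + (k−i) + (k+1) = 5(k−i) + 4(i+1)`).
* §3 **`sum_box_abs_dz_Psi_single_le`** — THE SAWTOOTH IN BLOCK-ℓ¹: for ALL `m k μ z κ c`,
  `Σ_{t ∈ box (Lc^{k+1})} |dz (Psi ρ Lc m k (single μ z)) κ (Lc^{k+1}•c + t)| ≤ 16·k·Lc·e^{κ₀}·C·(Lc^{k+1})⁻¹·e^{−κ₀‖c − z‖∞}`; and, for comparison,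
  `sum_box_abs_respStep_single_le` — the UNDRESSED column's block mass `Σ_{t} |T^B| ≤ C·(Lc^{k+1})⁻¹·e^{−κ₀‖c − z‖∞}`: the sawtooth costs the factor `16·k·Lc·e^{κ₀}`, no power of
  `L` — the kernel-leg hypothesis `hρ` of `ThreeLegDoubleFreeze` (RULING R-gan24p1-g36-1 (4)) is met by the dressed row with a `k`-linear constant.
Asserts NOTHING about Bałaban's tables; discharges NOTHING of (Q-L) ∕ (H1♮) ∕ (C) ∕ «T2Shape» ∕ «T2Drift» ∕ (hW, hWall); NEVER «G-an2-4 closed» as (CONV-C);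
NOT D1, NOT `BetaPertH`, NOT continuum, NOT Clay.  2026-08-23; no existing file touched.
-/

noncomputable section

open Finset
open scoped BigOperators
open Literature.MathematicalPhysics.QuantumFieldTheory
open Literature.MathematicalPhysics.QuantumFieldTheory.LatticeForm (quo)
open Literature.MathematicalPhysics.QuantumFieldTheory.Balaban1983to89
open Literature.MathematicalPhysics.QuantumFieldTheory.Balaban1983to89.Beta
open B4ContourShift (supNorm)
open AffineAveraging (Form0 Form1 Site box toSite unitVec dz)
open AveragingContours (blk)
open BalabanCompositeJets (respStep)
open KKTFluctuationEnergy (quo_zsmul_add_toSite)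
open Summit.QuantumFields.BalabanUV.Beta.AxialProjectorBlockMean (bmGaugeAt)
open Summit.QuantumFields.BalabanUV.Beta.GAN24.RespStepBmDecompLegs (legAct)
open Summit.QuantumFields.BalabanUV.Beta.GAN24.RespStepBmDecompExact (blk_blk_pow)
open Summit.QuantumFields.BalabanUV.Beta.GAN24.RespStepBmDecompPsi (Psi Psi_apply)
open Summit.QuantumFields.BalabanUV.Beta.GAN24.DressedLegEnvelope (bmGaugeAt_respStep_envelope blk_pow_blk_pow legAct_single)
open Summit.QuantumFields.BalabanUV.Beta.GAN24.StaircaseFaces (blk_add_unitVec_of_not_dvd env_add_unitVec_le)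
open Summit.QuantumFields.BalabanUV.Beta.GAN24.StaircaseFaceDensity (card_box_filter_dvd)
open Summit.QuantumFields.BalabanUV.Beta.GAN24.TransversalZeroMode (card_box_succ)

namespace Summit.QuantumFields.BalabanUV.Beta.GAN24.DressedLegSawtoothBlockL1

section Four

variable {Lc : ℕ} [NeZero Lc] {κ₀ C : ℝ}

/-! ## §1 One level's term of the accumulated gauge: envelope at any point, face jump -/

/-- [folklore] **THE `i`-TH TERM OF `Ψ_{m,k}` OF A SOURCE BOND KEEPS THE SOURCE-SCALE ENVELOPE AT EVERY FINE POINT** (the `have hterm` of leaf-01 g57's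
`DressedLegEnvelope.Psi_single_envelope`, isolated; `d = 3`, in-block root, `i < k`):
`|(Lc^{4(i+1)})⁻¹·bmGaugeAt ρ (R_{m+i+1 → m+k+1}(single μ z)) Lc (blk (Lc^{i+1}) y)| ≤ 8·Lc·C·(Lc^{5(k−i)})⁻¹·(Lc^{4(i+1)})⁻¹·e^{−κ₀‖quo (Lc^{k+1}) y − z‖∞}`. -/
theorem abs_PsiTerm_single_le
    (hN1 : ∀ (m k : ℕ) (μ : Fin (3 + 1)) (z : Site (3 + 1)) (l'' : Fin (3 + 1)) (w' : Site (3 + 1)),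
      |respStep (d := 3) (Lc ^ m) (Lc ^ (m + k + 1)) μ z l'' w'| ≤
        C * ((Lc : ℝ) ^ (5 * (k + 1)))⁻¹ * Real.exp (-(κ₀ * supNorm (quo (Lc ^ (k + 1)) w' - z))))
    {rr : Fin (3 + 1) → ℕ} (hrr : rr ∈ box (3 + 1) Lc) (m k i : ℕ) (hik : i < k) (μ : Fin (3 + 1)) (z y : Site (3 + 1)) :
    |((Lc : ℝ) ^ ((3 + 1) * (i + 1)))⁻¹ *
        bmGaugeAt (toSite rr) (legAct (respStep (d := 3) (Lc ^ (m + i + 1)) (Lc ^ (m + k + 1)))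
          (fun μ' y => if μ' = μ then (if y = z then (1 : ℝ) else 0) else 0)) Lc (blk (Lc ^ (i + 1)) y)|
      ≤ 8 * (Lc : ℝ) * C * ((Lc : ℝ) ^ (5 * (k - i)))⁻¹ * ((Lc : ℝ) ^ ((3 + 1) * (i + 1)))⁻¹ *
          Real.exp (-(κ₀ * supNorm (quo (Lc ^ (k + 1)) y - z))) := by
  have hL0 : (0 : ℝ) < Lc := by exact_mod_cast Nat.pos_of_ne_zero (NeZero.ne Lc)
  have hg := bmGaugeAt_respStep_envelope (Lc := Lc) hN1 hrr (m + i + 1) (k - i - 1) (m + k + 1) (by omega) μ z (blk (Lc ^ (i + 1)) y)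
  have hlab : blk (Lc ^ (k - i - 1)) (blk Lc (blk (Lc ^ (i + 1)) y)) = quo (Lc ^ (k + 1)) y := by
    rw [blk_blk_pow, blk_pow_blk_pow, show i + 1 + 1 + (k - i - 1) = k + 1 by omega]
    rfl
  rw [hlab, show k - i - 1 + 1 = k - i by omega] at hg
  rw [abs_mul, abs_inv, abs_pow, abs_of_pos hL0]
  calc ((Lc : ℝ) ^ ((3 + 1) * (i + 1)))⁻¹ * |bmGaugeAt (toSite rr)
          (legAct (respStep (d := 3) (Lc ^ (m + i + 1)) (Lc ^ (m + k + 1)))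
            (fun μ' y => if μ' = μ then (if y = z then (1 : ℝ) else 0) else 0)) Lc (blk (Lc ^ (i + 1)) y)|
      ≤ ((Lc : ℝ) ^ ((3 + 1) * (i + 1)))⁻¹ * (8 * (Lc : ℝ) * C * ((Lc : ℝ) ^ (5 * (k - i)))⁻¹ *
          Real.exp (-(κ₀ * supNorm (quo (Lc ^ (k + 1)) y - z)))) :=
        mul_le_mul_of_nonneg_left hg (by positivity)
    _ = 8 * (Lc : ℝ) * C * ((Lc : ℝ) ^ (5 * (k - i)))⁻¹ * ((Lc : ℝ) ^ ((3 + 1) * (i + 1)))⁻¹ *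
          Real.exp (-(κ₀ * supNorm (quo (Lc ^ (k + 1)) y - z))) := by ring

/-- [folklore] **THE FACE JUMP OF ONE LEVEL's TERM**: the `κ`-gradient of the `i`-th term of `Ψ_{m,k}(single μ z)` VANISHES off the `Lc^{i+1}`-faces
(`StaircaseFaces.blk_add_unitVec_of_not_dvd`) and is at most twice the envelope, one step wobbled (`e^{κ₀}`), on them. -/
theorem abs_dz_PsiTerm_single_le (hκ : 0 ≤ κ₀) (hC : 0 ≤ C)
    (hN1 : ∀ (m k : ℕ) (μ : Fin (3 + 1)) (z : Site (3 + 1)) (l'' : Fin (3 + 1)) (w' : Site (3 + 1)),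
      |respStep (d := 3) (Lc ^ m) (Lc ^ (m + k + 1)) μ z l'' w'| ≤
        C * ((Lc : ℝ) ^ (5 * (k + 1)))⁻¹ * Real.exp (-(κ₀ * supNorm (quo (Lc ^ (k + 1)) w' - z))))
    {rr : Fin (3 + 1) → ℕ} (hrr : rr ∈ box (3 + 1) Lc) (m k i : ℕ) (hik : i < k) (μ : Fin (3 + 1)) (z : Site (3 + 1))
    (κ : Fin (3 + 1)) (y : Site (3 + 1)) :
    |((Lc : ℝ) ^ ((3 + 1) * (i + 1)))⁻¹ *
        bmGaugeAt (toSite rr) (legAct (respStep (d := 3) (Lc ^ (m + i + 1)) (Lc ^ (m + k + 1)))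
          (fun μ' y => if μ' = μ then (if y = z then (1 : ℝ) else 0) else 0)) Lc (blk (Lc ^ (i + 1)) (y + unitVec κ))
      - ((Lc : ℝ) ^ ((3 + 1) * (i + 1)))⁻¹ *
        bmGaugeAt (toSite rr) (legAct (respStep (d := 3) (Lc ^ (m + i + 1)) (Lc ^ (m + k + 1)))
          (fun μ' y => if μ' = μ then (if y = z then (1 : ℝ) else 0) else 0)) Lc (blk (Lc ^ (i + 1)) y)|
      ≤ if ((Lc ^ (i + 1) : ℕ) : ℤ) ∣ y κ + 1 then
          16 * (Lc : ℝ) * C * ((Lc : ℝ) ^ (5 * (k - i)))⁻¹ * ((Lc : ℝ) ^ ((3 + 1) * (i + 1)))⁻¹ * Real.exp κ₀ *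
            Real.exp (-(κ₀ * supNorm (quo (Lc ^ (k + 1)) y - z)))
        else 0 := by
  have hL0 : (0 : ℝ) < Lc := by exact_mod_cast Nat.pos_of_ne_zero (NeZero.ne Lc)
  have hP : 1 ≤ Lc ^ (i + 1) := Nat.one_le_pow _ _ (Nat.pos_of_ne_zero (NeZero.ne Lc))
  by_cases hdvd : ((Lc ^ (i + 1) : ℕ) : ℤ) ∣ y κ + 1
  · rw [if_pos hdvd]
    have h1 := abs_PsiTerm_single_le hN1 hrr m k i hik μ z (y + unitVec κ)
    have h0 := abs_PsiTerm_single_le hN1 hrr m k i hik μ z y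
    haveI : NeZero (Lc ^ (k + 1)) := ⟨pow_ne_zero _ (NeZero.ne Lc)⟩
    have hw := env_add_unitVec_le (N := Lc ^ (k + 1)) hκ z y κ
    set E : ℝ := Real.exp (-(κ₀ * supNorm (quo (Lc ^ (k + 1)) y - z))) with hE
    have hE0 : 0 ≤ E := (Real.exp_pos _).le
    have hA : 0 ≤ 8 * (Lc : ℝ) * C * ((Lc : ℝ) ^ (5 * (k - i)))⁻¹ * ((Lc : ℝ) ^ ((3 + 1) * (i + 1)))⁻¹ := by positivity
    have hexp1 : 1 ≤ Real.exp κ₀ := Real.one_le_exp hκ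
    calc _ ≤ |((Lc : ℝ) ^ ((3 + 1) * (i + 1)))⁻¹ *
              bmGaugeAt (toSite rr) (legAct (respStep (d := 3) (Lc ^ (m + i + 1)) (Lc ^ (m + k + 1)))
                (fun μ' y => if μ' = μ then (if y = z then (1 : ℝ) else 0) else 0)) Lc (blk (Lc ^ (i + 1)) (y + unitVec κ))|
            + |((Lc : ℝ) ^ ((3 + 1) * (i + 1)))⁻¹ *
              bmGaugeAt (toSite rr) (legAct (respStep (d := 3) (Lc ^ (m + i + 1)) (Lc ^ (m + k + 1)))
                (fun μ' y => if μ' = μ then (if y = z then (1 : ℝ) else 0) else 0)) Lc (blk (Lc ^ (i + 1)) y)| := abs_sub _ _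
      _ ≤ 8 * (Lc : ℝ) * C * ((Lc : ℝ) ^ (5 * (k - i)))⁻¹ * ((Lc : ℝ) ^ ((3 + 1) * (i + 1)))⁻¹ *
              Real.exp (-(κ₀ * supNorm (quo (Lc ^ (k + 1)) (y + unitVec κ) - z)))
            + 8 * (Lc : ℝ) * C * ((Lc : ℝ) ^ (5 * (k - i)))⁻¹ * ((Lc : ℝ) ^ ((3 + 1) * (i + 1)))⁻¹ * E := add_le_add h1 h0
      _ ≤ 8 * (Lc : ℝ) * C * ((Lc : ℝ) ^ (5 * (k - i)))⁻¹ * ((Lc : ℝ) ^ ((3 + 1) * (i + 1)))⁻¹ * (Real.exp κ₀ * E)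
            + 8 * (Lc : ℝ) * C * ((Lc : ℝ) ^ (5 * (k - i)))⁻¹ * ((Lc : ℝ) ^ ((3 + 1) * (i + 1)))⁻¹ * (Real.exp κ₀ * E) :=
          add_le_add (mul_le_mul_of_nonneg_left hw hA)
            (mul_le_mul_of_nonneg_left (by
              calc E = 1 * E := (one_mul E).symm
                _ ≤ Real.exp κ₀ * E := mul_le_mul_of_nonneg_right hexp1 hE0) hA)
      _ = _ := by ring
  · rw [if_neg hdvd, blk_add_unitVec_of_not_dvd hP hdvd, sub_self, abs_zero]

/-! ## §2 The gradient of `Ψ` level by level; one level's sawtooth in block-ℓ¹ over a source block -/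

/-- [folklore] The `κ`-gradient of the accumulated gauge is (minus) the sum of the level gradients (`Psi_apply` at the two points). -/
theorem dz_Psi_apply (rr : Fin (3 + 1) → ℕ) (m k : ℕ) (b : Form1 (3 + 1) ℝ) (κ : Fin (3 + 1)) (y : Site (3 + 1)) :
    dz (Psi (toSite rr) Lc m k b) κ y
      = -∑ i ∈ Finset.range k,
          (((Lc : ℝ) ^ ((3 + 1) * (i + 1)))⁻¹ *
              bmGaugeAt (toSite rr) (legAct (respStep (d := 3) (Lc ^ (m + i + 1)) (Lc ^ (m + k + 1))) b) Lc (blk (Lc ^ (i + 1)) (y + unitVec κ))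
            - ((Lc : ℝ) ^ ((3 + 1) * (i + 1)))⁻¹ *
              bmGaugeAt (toSite rr) (legAct (respStep (d := 3) (Lc ^ (m + i + 1)) (Lc ^ (m + k + 1))) b) Lc (blk (Lc ^ (i + 1)) y)) := by
  simp only [dz, Psi_apply, Finset.sum_sub_distrib]
  ring

omit [NeZero Lc] in
/-- [folklore] On the source block `L•c + box L` (`L = Lc^{k+1}`, `i < k`) the face condition of scale `Lc^{i+1}` reads on the OFFSET:
`Lc^{i+1} ∣ (L•c + t)_κ + 1 ↔ Lc^{i+1} ∣ t_κ + 1` (`Lc^{i+1} ∣ L`). -/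
theorem dvd_coord_iff (k i : ℕ) (hik : i < k) (c : Site (3 + 1)) (t : Fin (3 + 1) → ℕ) (κ : Fin (3 + 1)) :
    ((Lc ^ (i + 1) : ℕ) : ℤ) ∣ ((((Lc ^ (k + 1) : ℕ) : ℤ) • c + toSite t) κ + 1) ↔ Lc ^ (i + 1) ∣ t κ + 1 := by
  have hdivL : ((Lc ^ (i + 1) : ℕ) : ℤ) ∣ ((Lc ^ (k + 1) : ℕ) : ℤ) := by
    exact_mod_cast pow_dvd_pow Lc (by omega : i + 1 ≤ k + 1)
  have e : ((((Lc ^ (k + 1) : ℕ) : ℤ) • c + toSite t) κ + 1) = ((Lc ^ (k + 1) : ℕ) : ℤ) * c κ + ((t κ + 1 : ℕ) : ℤ) := by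
    simp only [Pi.add_apply, Pi.smul_apply, smul_eq_mul, toSite]
    push_cast
    ring
  rw [e, Int.dvd_add_right (Dvd.dvd.mul_right hdivL _), Int.natCast_dvd_natCast]

/-- NOT IN PRINT; OUR BOOKKEEPING.  **ONE LEVEL's SAWTOOTH IN BLOCK-ℓ¹ IS `T^B`-SIZED, INDEPENDENTLY OF THE LEVEL** (`d = 3`, in-block root, `i < k`):
over the source block of label `c` (`L = Lc^{k+1}` fine sites per side),
`Σ_{t ∈ box L} |Ψ_i(L•c + t + e_κ) − Ψ_i(L•c + t)| ≤ 16·Lc·e^{κ₀}·C·(Lc^{k+1})⁻¹·e^{−κ₀‖c − z‖∞}` — the `L^3·(L∕Lc^{i+1})` face sites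
(`StaircaseFaceDensity.card_box_filter_dvd`) times the level's jump `16·Lc·C·(Lc^{5(k−i)})⁻¹·(Lc^{4(i+1)})⁻¹·e^{κ₀}·E(c)`; the exponents cancel:
`3(k+1) + (k−i) + (k+1) = 5(k−i) + 4(i+1)`. -/
theorem sum_box_abs_dz_PsiTerm_single_le (hκ : 0 ≤ κ₀) (hC : 0 ≤ C)
    (hN1 : ∀ (m k : ℕ) (μ : Fin (3 + 1)) (z : Site (3 + 1)) (l'' : Fin (3 + 1)) (w' : Site (3 + 1)),
      |respStep (d := 3) (Lc ^ m) (Lc ^ (m + k + 1)) μ z l'' w'| ≤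
        C * ((Lc : ℝ) ^ (5 * (k + 1)))⁻¹ * Real.exp (-(κ₀ * supNorm (quo (Lc ^ (k + 1)) w' - z))))
    {rr : Fin (3 + 1) → ℕ} (hrr : rr ∈ box (3 + 1) Lc) (m k i : ℕ) (hik : i < k) (μ : Fin (3 + 1)) (z : Site (3 + 1))
    (κ : Fin (3 + 1)) (c : Site (3 + 1)) :
    ∑ t ∈ box (3 + 1) (Lc ^ (k + 1)),
      |((Lc : ℝ) ^ ((3 + 1) * (i + 1)))⁻¹ *
          bmGaugeAt (toSite rr) (legAct (respStep (d := 3) (Lc ^ (m + i + 1)) (Lc ^ (m + k + 1)))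
            (fun μ' y => if μ' = μ then (if y = z then (1 : ℝ) else 0) else 0)) Lc
              (blk (Lc ^ (i + 1)) ((((Lc ^ (k + 1) : ℕ) : ℤ) • c + toSite t) + unitVec κ))
        - ((Lc : ℝ) ^ ((3 + 1) * (i + 1)))⁻¹ *
          bmGaugeAt (toSite rr) (legAct (respStep (d := 3) (Lc ^ (m + i + 1)) (Lc ^ (m + k + 1)))
            (fun μ' y => if μ' = μ then (if y = z then (1 : ℝ) else 0) else 0)) Lc
              (blk (Lc ^ (i + 1)) (((Lc ^ (k + 1) : ℕ) : ℤ) • c + toSite t))|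
      ≤ 16 * (Lc : ℝ) * Real.exp κ₀ * C * ((Lc : ℝ) ^ (k + 1))⁻¹ * Real.exp (-(κ₀ * supNorm (c - z))) := by
  classical
  have hL0 : (0 : ℝ) < Lc := by exact_mod_cast Nat.pos_of_ne_zero (NeZero.ne Lc)
  have hne : (Lc : ℝ) ≠ 0 := hL0.ne'
  haveI : NeZero (Lc ^ (k + 1)) := ⟨pow_ne_zero _ (NeZero.ne Lc)⟩
  set E : ℝ := Real.exp (-(κ₀ * supNorm (c - z))) with hE
  set J : ℝ := 16 * (Lc : ℝ) * C * ((Lc : ℝ) ^ (5 * (k - i)))⁻¹ * ((Lc : ℝ) ^ ((3 + 1) * (i + 1)))⁻¹ * Real.exp κ₀ * E with hJ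
  -- every point of the source block carries the label `c`
  have hlab : ∀ t ∈ box (3 + 1) (Lc ^ (k + 1)), quo (Lc ^ (k + 1)) (((Lc ^ (k + 1) : ℕ) : ℤ) • c + toSite t) = c :=
    fun t ht => quo_zsmul_add_toSite c ht
  -- pointwise: the face jump on the faces, zero elsewhere
  have hpt : ∀ t ∈ box (3 + 1) (Lc ^ (k + 1)),
      |((Lc : ℝ) ^ ((3 + 1) * (i + 1)))⁻¹ *
          bmGaugeAt (toSite rr) (legAct (respStep (d := 3) (Lc ^ (m + i + 1)) (Lc ^ (m + k + 1)))
            (fun μ' y => if μ' = μ then (if y = z then (1 : ℝ) else 0) else 0)) Lc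
              (blk (Lc ^ (i + 1)) ((((Lc ^ (k + 1) : ℕ) : ℤ) • c + toSite t) + unitVec κ))
        - ((Lc : ℝ) ^ ((3 + 1) * (i + 1)))⁻¹ *
          bmGaugeAt (toSite rr) (legAct (respStep (d := 3) (Lc ^ (m + i + 1)) (Lc ^ (m + k + 1)))
            (fun μ' y => if μ' = μ then (if y = z then (1 : ℝ) else 0) else 0)) Lc
              (blk (Lc ^ (i + 1)) (((Lc ^ (k + 1) : ℕ) : ℤ) • c + toSite t))|
        ≤ if Lc ^ (i + 1) ∣ t κ + 1 then J else 0 := by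
    intro t ht
    have h := abs_dz_PsiTerm_single_le hκ hC hN1 hrr m k i hik μ z κ (((Lc ^ (k + 1) : ℕ) : ℤ) • c + toSite t)
    rw [hlab t ht] at h
    by_cases hd : Lc ^ (i + 1) ∣ t κ + 1
    · have hd' : ((Lc ^ (i + 1) : ℕ) : ℤ) ∣ ((((Lc ^ (k + 1) : ℕ) : ℤ) • c + toSite t) κ + 1) :=
        (dvd_coord_iff (Lc := Lc) k i hik c t κ).2 hd
      rw [if_pos hd'] at h
      rw [if_pos hd]
      exact h.trans (le_of_eq (by rw [hJ]))
    · have hd' : ¬ ((Lc ^ (i + 1) : ℕ) : ℤ) ∣ ((((Lc ^ (k + 1) : ℕ) : ℤ) • c + toSite t) κ + 1) :=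
        fun h' => hd ((dvd_coord_iff (Lc := Lc) k i hik c t κ).1 h')
      rw [if_neg hd'] at h
      rw [if_neg hd]
      exact h
  refine (Finset.sum_le_sum hpt).trans ?_
  rw [Finset.sum_ite, Finset.sum_const_zero, add_zero, Finset.sum_const, nsmul_eq_mul,
    card_box_filter_dvd (Lc ^ (k + 1)) (Lc ^ (i + 1)) κ]
  -- the face count `L^3 · (L / Lc^{i+1}) = Lc^{3(k+1)} · Lc^{k−i}`
  have hLP : Lc ^ (k + 1) / Lc ^ (i + 1) = Lc ^ (k - i) := by
    rw [Nat.pow_div (by omega) (Nat.pos_of_ne_zero (NeZero.ne Lc))]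
    congr 1
    omega
  rw [hLP]
  push_cast
  -- the exponents cancel: `3(k+1) + (k−i) + (k+1) = 5(k−i) + 4(i+1)`
  have hcomb : ((Lc : ℝ) ^ (5 * (k - i)))⁻¹ * ((Lc : ℝ) ^ ((3 + 1) * (i + 1)))⁻¹
      = ((Lc : ℝ) ^ (3 * (k + 1) + (k - i)))⁻¹ * ((Lc : ℝ) ^ (k + 1))⁻¹ := by
    rw [← mul_inv, ← mul_inv, ← pow_add, ← pow_add]
    congr 2
    omega
  have hN0 : (Lc : ℝ) ^ (3 * (k + 1) + (k - i)) ≠ 0 := pow_ne_zero _ hne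
  have hpow : ((Lc : ℝ) ^ (k + 1)) ^ 3 * (Lc : ℝ) ^ (k - i) = (Lc : ℝ) ^ (3 * (k + 1) + (k - i)) := by
    rw [← pow_mul, ← pow_add, Nat.mul_comm]
  calc ((Lc : ℝ) ^ (k + 1)) ^ 3 * (Lc : ℝ) ^ (k - i) * J
      = (Lc : ℝ) ^ (3 * (k + 1) + (k - i)) *
          (16 * (Lc : ℝ) * C * (((Lc : ℝ) ^ (5 * (k - i)))⁻¹ * ((Lc : ℝ) ^ ((3 + 1) * (i + 1)))⁻¹) * Real.exp κ₀ * E) := by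
        rw [hpow, hJ]; ring
    _ = 16 * (Lc : ℝ) * Real.exp κ₀ * C * ((Lc : ℝ) ^ (k + 1))⁻¹ * E *
          ((Lc : ℝ) ^ (3 * (k + 1) + (k - i)) * ((Lc : ℝ) ^ (3 * (k + 1) + (k - i)))⁻¹) := by
        rw [hcomb]; ring
    _ = 16 * (Lc : ℝ) * Real.exp κ₀ * C * ((Lc : ℝ) ^ (k + 1))⁻¹ * E := by
        rw [mul_inv_cancel₀ hN0, mul_one]
    _ ≤ _ := le_rfl


/-! ## §3 The sawtooth in block-ℓ¹; the undressed column's block mass for comparison -/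

/-- NOT IN PRINT; OUR BOOKKEEPING.  **THE GAUGE SAWTOOTH OF THE DRESSED COMPOSITE LEGS IS `T^B`-SIZED IN BLOCK-ℓ¹** (RULING R-gan24p1-g36-1 (4)(B);
`d = 3`, `[NeZero Lc]`, in-block root `ρ = toSite rr`, parametric in leaf-12's (N1) data `κ₀ ≥ 0`, `C ≥ 0`): for ALL `m k μ z κ c`,
`Σ_{t ∈ box (Lc^{k+1})} |dz (Psi ρ Lc m k (single μ z)) κ (Lc^{k+1}•c + t)| ≤ 16·k·Lc·e^{κ₀}·C·(Lc^{k+1})⁻¹·e^{−κ₀‖c − z‖∞}` — the `k` intermediate levels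
contribute EQUALLY (§2); compare `sum_box_abs_respStep_single_le`: the undressed column's block mass is `C·(Lc^{k+1})⁻¹·e^{−κ₀‖c − z‖∞}`.  So in the block-ℓ¹
currency of the (H1♮) core's kernel leg (`ThreeLegDoubleFreeze`'s `hρ`) the inter-block gauge costs the factor `16·k·Lc·e^{κ₀}` and NO power of the relative blocking. -/
theorem sum_box_abs_dz_Psi_single_le (hκ : 0 ≤ κ₀) (hC : 0 ≤ C)
    (hN1 : ∀ (m k : ℕ) (μ : Fin (3 + 1)) (z : Site (3 + 1)) (l'' : Fin (3 + 1)) (w' : Site (3 + 1)),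
      |respStep (d := 3) (Lc ^ m) (Lc ^ (m + k + 1)) μ z l'' w'| ≤
        C * ((Lc : ℝ) ^ (5 * (k + 1)))⁻¹ * Real.exp (-(κ₀ * supNorm (quo (Lc ^ (k + 1)) w' - z))))
    {rr : Fin (3 + 1) → ℕ} (hrr : rr ∈ box (3 + 1) Lc) (m k : ℕ) (μ : Fin (3 + 1)) (z : Site (3 + 1)) (κ : Fin (3 + 1)) (c : Site (3 + 1)) :
    ∑ t ∈ box (3 + 1) (Lc ^ (k + 1)),
      |dz (Psi (toSite rr) Lc m k (fun μ' y => if μ' = μ then (if y = z then (1 : ℝ) else 0) else 0)) κ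
          (((Lc ^ (k + 1) : ℕ) : ℤ) • c + toSite t)|
      ≤ 16 * (k : ℝ) * (Lc : ℝ) * Real.exp κ₀ * C * ((Lc : ℝ) ^ (k + 1))⁻¹ * Real.exp (-(κ₀ * supNorm (c - z))) := by
  have hpt : ∀ t ∈ box (3 + 1) (Lc ^ (k + 1)),
      |dz (Psi (toSite rr) Lc m k (fun μ' y => if μ' = μ then (if y = z then (1 : ℝ) else 0) else 0)) κ
          (((Lc ^ (k + 1) : ℕ) : ℤ) • c + toSite t)|
        ≤ ∑ i ∈ Finset.range k,
          |((Lc : ℝ) ^ ((3 + 1) * (i + 1)))⁻¹ *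
              bmGaugeAt (toSite rr) (legAct (respStep (d := 3) (Lc ^ (m + i + 1)) (Lc ^ (m + k + 1)))
                (fun μ' y => if μ' = μ then (if y = z then (1 : ℝ) else 0) else 0)) Lc
                  (blk (Lc ^ (i + 1)) ((((Lc ^ (k + 1) : ℕ) : ℤ) • c + toSite t) + unitVec κ))
            - ((Lc : ℝ) ^ ((3 + 1) * (i + 1)))⁻¹ *
              bmGaugeAt (toSite rr) (legAct (respStep (d := 3) (Lc ^ (m + i + 1)) (Lc ^ (m + k + 1)))
                (fun μ' y => if μ' = μ then (if y = z then (1 : ℝ) else 0) else 0)) Lc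
                  (blk (Lc ^ (i + 1)) (((Lc ^ (k + 1) : ℕ) : ℤ) • c + toSite t))| := by
    intro t _
    rw [dz_Psi_apply, abs_neg]
    exact Finset.abs_sum_le_sum_abs _ _
  refine (Finset.sum_le_sum hpt).trans ?_
  rw [Finset.sum_comm]
  refine (Finset.sum_le_sum fun i hi =>
    sum_box_abs_dz_PsiTerm_single_le hκ hC hN1 hrr m k i (Finset.mem_range.1 hi) μ z κ c).trans (le_of_eq ?_)
  rw [Finset.sum_const, Finset.card_range, nsmul_eq_mul]
  ring

/-- [folklore] **THE UNDRESSED COMPOSITE COLUMN's BLOCK MASS** (leaf-12's (N1) envelope summed over the `(Lc^{k+1})^4` points of a source block, on which it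
is constant): `Σ_{t ∈ box (Lc^{k+1})} |respStep (Lc^m) (Lc^(m+k+1)) μ z l″ (Lc^{k+1}•c + t)| ≤ C·(Lc^{k+1})⁻¹·e^{−κ₀‖c − z‖∞}` — the comparison size for §3. -/
theorem sum_box_abs_respStep_single_le
    (hN1 : ∀ (m k : ℕ) (μ : Fin (3 + 1)) (z : Site (3 + 1)) (l'' : Fin (3 + 1)) (w' : Site (3 + 1)),
      |respStep (d := 3) (Lc ^ m) (Lc ^ (m + k + 1)) μ z l'' w'| ≤
        C * ((Lc : ℝ) ^ (5 * (k + 1)))⁻¹ * Real.exp (-(κ₀ * supNorm (quo (Lc ^ (k + 1)) w' - z))))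
    (m k : ℕ) (μ : Fin (3 + 1)) (z : Site (3 + 1)) (l'' : Fin (3 + 1)) (c : Site (3 + 1)) :
    ∑ t ∈ box (3 + 1) (Lc ^ (k + 1)), |respStep (d := 3) (Lc ^ m) (Lc ^ (m + k + 1)) μ z l'' (((Lc ^ (k + 1) : ℕ) : ℤ) • c + toSite t)|
      ≤ C * ((Lc : ℝ) ^ (k + 1))⁻¹ * Real.exp (-(κ₀ * supNorm (c - z))) := by
  have hL0 : (0 : ℝ) < Lc := by exact_mod_cast Nat.pos_of_ne_zero (NeZero.ne Lc)
  have hne : (Lc : ℝ) ≠ 0 := hL0.ne'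
  haveI : NeZero (Lc ^ (k + 1)) := ⟨pow_ne_zero _ (NeZero.ne Lc)⟩
  have hpt : ∀ t ∈ box (3 + 1) (Lc ^ (k + 1)),
      |respStep (d := 3) (Lc ^ m) (Lc ^ (m + k + 1)) μ z l'' (((Lc ^ (k + 1) : ℕ) : ℤ) • c + toSite t)|
        ≤ C * ((Lc : ℝ) ^ (5 * (k + 1)))⁻¹ * Real.exp (-(κ₀ * supNorm (c - z))) := by
    intro t ht
    have h := hN1 m k μ z l'' (((Lc ^ (k + 1) : ℕ) : ℤ) • c + toSite t)
    rwa [quo_zsmul_add_toSite c ht] at h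
  refine (Finset.sum_le_sum hpt).trans (le_of_eq ?_)
  rw [Finset.sum_const, card_box_succ, nsmul_eq_mul]
  push_cast
  have hN0 : ((Lc : ℝ) ^ (k + 1)) ^ 4 ≠ 0 := pow_ne_zero _ (pow_ne_zero _ hne)
  have e : (Lc : ℝ) ^ (5 * (k + 1)) = ((Lc : ℝ) ^ (k + 1)) ^ 4 * (Lc : ℝ) ^ (k + 1) := by
    rw [← pow_mul, ← pow_add]; congr 1; ring
  rw [e, mul_inv]
  calc ((Lc : ℝ) ^ (k + 1)) ^ 4 * (C * ((((Lc : ℝ) ^ (k + 1)) ^ 4)⁻¹ * ((Lc : ℝ) ^ (k + 1))⁻¹) * Real.exp (-(κ₀ * supNorm (c - z))))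
      = C * ((Lc : ℝ) ^ (k + 1))⁻¹ * Real.exp (-(κ₀ * supNorm (c - z))) * (((Lc : ℝ) ^ (k + 1)) ^ 4 * (((Lc : ℝ) ^ (k + 1)) ^ 4)⁻¹) := by ring
    _ = C * ((Lc : ℝ) ^ (k + 1))⁻¹ * Real.exp (-(κ₀ * supNorm (c - z))) := by rw [mul_inv_cancel₀ hN0, mul_one]

end Four

end Summit.QuantumFields.BalabanUV.Beta.GAN24.DressedLegSawtoothBlockL1

end
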